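import Literature.AlgebraicGeometry.Resolution.PointBlowupMohBound
import Literature.AlgebraicGeometry.Resolution.HasseSchmidtCoefficients
import Mathlib.Data.Nat.Choose.Lucas
import Mathlib.NumberTheory.Padics.PadicVal.Basic
import HarnessLib

/-!
# Moh's bound at order `p^e` in every dimension: one point blow-up raises the shade by at most `p^{e−1}`

Topic: `Literature/AlgebraicGeometry/Resolution`. Reproduction (cell `pub-hironaka`, unit
`b2b-hironaka-cp4`, DIM-4 CENSUS gen 14; sequel of `PointBlowupMohBound.lean`, which proves the
case `e = 1`) of the ONE-BLOW-UP half of Moh's Stability Theorem for an arbitrary exponent `e ≥ 1`,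
i.e. of the predicate `PointBlowup.MohBound p e j b s` of `PointBlowupShade.lean` ("Moh's bound as a
PREDICATE … Not asserted here; the atlas tests it row by row") for EVERY `e ≥ 1`:

* T. T. Moh, *On a stability theorem for local uniformization in characteristic `p`*, Publ. RIMS
  Kyoto Univ. **23** (1987) 965–973 [Moh1987]: Introduction, p. 966, "**The Stability Theorem.**
  Let `d = ord F(x₁,…,x_n)`. After a permissible blowup … factor out `x₁` and let `F = x₁ᵈ F̄`.
  Then `ord F̄ ≤ d + p^{e−1}` … (in fact, `d + pʳ`, see below)", for the purely inseparable
  equation `z^{pᵉ} + ∏ xᵢ^{mᵢ} F(x₁,…,x_n) = 0` in any number `n` of variables; proved in §1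
  (pp. 968–970) with the Hasse derivations `d^{(pʳ)}` ("Proposition 1": `d^{(pʳ)}` kills
  `p^{r+1}`-th powers and is a derivation on `k[y^{pʳ}]`; "Proposition 2": the bound `+pʳ`).
* H. Hauser, *On the problem of resolution of singularities in positive characteristic*,
  Bull. AMS **47** (2010) 1–30 [Hauser2010], §F "Proposition (Moh)" (p. 16): for
  `f = x^{pᵉ} + yʳ·g(y)` and an equiconstant point `a′` of the point blow-up,
  "`shade_{a′} f′ ≤ shade_a f + p^{e−1}`".
* H. Hauser, S. Perlega, *Characterizing the increase of the residual order under blowup in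
  positive characteristic*, Publ. RIMS **55** (2019) 835–857 = arXiv:1906.09593
  [HauserPerlega2019PRIMS], §3 Theorem, assertion (9) "residual-order_{D′} J′ ≤
  residual-order_D J + c!/p" for ideals of order `c = m·pᵉ` in any dimension `n + 1`, with
  its PROOF (§5, last page): for `0 ≤ k < e` and an index `i` with `∂_{x_i^{p^k}}(F) ≠ 0`,
  "`∂_{x_i^{p^k}}(G^q) = 0`. Consequently `ord(F + G^q) ≤ ord ∂_{x_i^{p^k}}(F) + p^k`", the slack
  `ε_{i,k} = p^k` if `i` is an exceptional index and `0` otherwise, and "`ℓ` was chosen maximal such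
  that `F` is a `p^ℓ`-th power … this implies the existence of an index `i` such that
  `∂_{x_i^{p^ℓ}}(F) ≠ 0` … `ord I₁′ ≤ ord I + (c!/q)·p^ℓ ≤ ord I + c!/p`, which proves (9)";
  Comment (h): "Assertion (2) and the bound in (9) have been known to Moh in the case of a purely
  inseparable hypersurface singularity". For `c = q = pᵉ` (`m = 1`) their residual order is
  `(q−1)!` times Hauser's shade and `(c!/q)·p^ℓ = (q−1)!·p^ℓ`, i.e. the bound is `+p^ℓ ≤ +p^{e−1}`
  on the shade.

## What is proved (all elementary; every field `K` of characteristic `p`, every finite index type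
## `σ` of residual variables — i.e. hypersurfaces `x^{pᵉ} + F(y) = 0` of EVERY dimension)

For `q = pᵉ`, a state `s = (F, r)` of `PointBlowupShade.lean` with `F` CLEANED
(`deletePthPowers q F = F`: no monomial of `F` is a `q`-th power), `yʳ ∣ F` monomialwise,
`ord₀ F = o ≥ q`, and ANY point `b` of the exceptional divisor of the blow-up of the origin read in
the `y_j`-chart (`b_j = 0`; no equimultiplicity, perfectness or algebraic-closure hypothesis):

* no increase if `q ∤ ord₀ F` (Hauser–Perlega (2) for `c = q`, `m = 1`: "`o = w·c!`",
  contrapositive): this is `PointBlowup.shade_step_le_of_not_dvd` of the `e = 1` file read with `q`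
  in place of `p` (that theorem is stated for any natural number; used, not restated).
* `PointBlowup.exists_support_step_of_choose_ne_zero` — **the Hasse probe**: if an initial monomial
  `y^{d₀}` of `F` (`|d₀| = o`) has `(d₀)_{i₀} choose p^k ≢ 0 (mod p)` at an index `i₀ ≠ j`, for some
  `k < e`, then the cleaned transform has a monomial `y^E` with `q ∤ E_{i₀}`, `E_j = o − q`, of
  degree `≤ |r′| + shade + [b_{i₀} ≠ 0]·min(p^k, r_{i₀})`; whence
  `PointBlowup.shade_step_le_of_choose_ne_zero` (no increase if `b_{i₀} = 0 ∨ r_{i₀} = 0`: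
  Hauser–Perlega (7) for `c = q`, read in fixed coordinates) and
  `PointBlowup.shade_step_le_add_of_choose_ne_zero` (`shade′ ≤ shade + min(p^k, r_{i₀})`).
* `PointBlowup.shade_step_le_add_pow` — **the `ℓ`-form of (9)**: if the initial form of `F` is not
  a `p^{ℓ+1}`-th power (some initial exponent is not divisible by `p^{ℓ+1}`) and `ℓ < e`, then
  `shade′ ≤ shade + p^ℓ` ("`ord I₁′ ≤ ord I + (c!/q)·p^ℓ`"; Moh's "in fact, `d + pʳ`").
* **`PointBlowup.mohBound` — `MohBound p e j b s` for every `e ≥ 1`**: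
  `shade(step q j b s) ≤ shade(s) + p^{e−1}` (the case `ℓ = e − 1`, available by cleanness).
* `PointBlowup.necessary_of_shadeIncreases_pow` — necessary conditions for an increase at order
  `q`: `q ∣ ord₀ F`; every `y_i` (`i ≠ j`, `b_i = 0 ∨ r_i = 0`) occurs in the initial form with
  exponents `≡ 0 (mod q)` only; some lost EXCEPTIONAL component `i₀ ≠ j` (`b_{i₀} ≠ 0`, `r_{i₀} ≥ 1`)
  carries an initial exponent not divisible by `q` (Hauser–Perlega (2), (7), Comment (d), `c = q`).
* `PointBlowup.shade_succ_le_along_pow` — along any sequence of such point blow-ups on which the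
  order stays `≥ q`, EVERY step satisfies `shade_{n+1} ≤ shade_n + p^{e−1}`.

## Method

Moh's / Hauser–Perlega's Hasse-derivative argument, organised exactly as the two probes of the `e = 1`
file with `∂/∂y_{i₀}` replaced by the Hasse–Schmidt derivative `D^{(p^k·e_{i₀})}` of the tree
(`Resolution.hasseDeriv`, `HasseSchmidtDerivatives.lean`; coefficient formula
`coeff_hasseDeriv_single` of `HasseSchmidtCoefficients.lean`): `D^{(a·e_i)}` sends `c·y^m` to
`(m_i choose a)·c·y^{m − a·e_i}` (`hasseDeriv_single_monomial`), commutes with translations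
(`hasseDeriv_translate`: `f(y + b + u) = (f(y + u))|_{y ↦ y + b}`), and by Lucas' theorem
(`Choose.choose_modEq_choose_mod_mul_choose_div_nat` of Mathlib) `(m choose p^k) ≡ ⌊m/p^k⌋ (mod p)`
(`choose_prime_pow_modEq_div`), so that `(m choose p^k) ≢ 0 (mod p)` for some `k < e` iff
`pᵉ ∤ m` (`natCast_choose_prime_pow_eq_zero_of_pow_dvd`, `exists_natCast_choose_prime_pow_ne_zero`):
a monomial of `D^{(p^k·e_{i₀})}G` (`G` the translated chart transform) with non-zero coefficient
gives a monomial of `G` which is not a `q`-th power, hence survives the cleaning. The layer lemma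
`exists_mem_support_translate_layer` of the `e = 1` file controls the degree; the slack is
`a = p^k` instead of `1` at a lost exceptional component (`rm = r − a·e_{i₀}`, truncated).

## What is NOT proved here (scope, honest)

* The SEQUENCE form of Moh's statement ("will not increase `ord F̄` beyond the bound `d + p^{e−1}` …
  until it drops to `d` or less"): PROVED in the tree for `e = 1` (`PointBlowupMohStability.lean`),
  FALSE for `e ≥ 3` (`Literature.Barriers.ResolutionOfSingularities.mohStabilityClaim_false`,
  Hauser–Perlega, J. Algebraic Geom. 2019 §3: "This disproves Moh's claim in the case `e ≥ 3` (it is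
  known to be valid for `e = 1`)"), and — to this cell's knowledge — neither proved nor refuted in
  print for `e = 2`; nothing about it is asserted here.
* Hauser–Perlega's assertions (3)–(6), (8) (the shape of the tangent cone and the residue inequality)
  and the equality cases; centres of positive dimension (`CentreBlowupMohStability.lean` treats
  `e = 1` only).
* Nothing here is a statement about resolution of singularities; census value only (row O5 of the
  dimension-4 census of `pub-hironaka`: at multiplicity `pᵉ` the classical residual order cannot jump
  by more than `p^{e−1}` per point blow-up in ANY dimension, kernel-checked; the reading notes
  R-Moh-1 of `PointBlowupMohBound.lean` on cleaning vs. perfectness and on non-equiconstant points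
  apply verbatim).
-/

noncomputable section

open MvPolynomial Finset

open scoped BigOperators

namespace Literature.AlgebraicGeometry.Resolution

open Literature.AlgebraicGeometry.Resolution.Hauser2010
open Literature.Barriers.ResolutionOfSingularities
open Literature.AlgebraicGeometry.Resolution.WeightedBlowup

/-! ## 1. Lucas: `(m choose p^k) ≡ ⌊m / p^k⌋ (mod p)` and its two consequences -/

section Lucas

variable (p : ℕ) [hp : Fact p.Prime]

/-- `(m choose p^k) ≡ ⌊m/p^k⌋ (mod p)`: the `k`-th `p`-adic digit of `m` (Lucas' theorem with the
one-digit lower index `p^k`). [folklore] -/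
theorem choose_prime_pow_modEq_div (m k : ℕ) : m.choose (p ^ k) ≡ m / p ^ k [MOD p] := by
  induction k generalizing m with
  | zero => simp only [pow_zero, Nat.choose_one_right, Nat.div_one, Nat.ModEq.refl]
  | succ k ih =>
    have h := Choose.choose_modEq_choose_mod_mul_choose_div_nat (n := m) (k := p ^ (k + 1)) (p := p)
    have h1 : p ^ (k + 1) % p = 0 := by
      rw [pow_succ]; exact Nat.mul_mod_left _ _
    have h2 : p ^ (k + 1) / p = p ^ k := by
      rw [pow_succ]; exact Nat.mul_div_cancel _ hp.out.pos
    rw [h1, h2, Nat.choose_zero_right, one_mul] at h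
    refine h.trans ?_
    have h3 := ih (m / p)
    rwa [Nat.div_div_eq_div_mul, mul_comm, ← pow_succ] at h3

variable (K : Type*) [CommRing K] [CharP K p]

/-- In characteristic `p`: `(m choose p^k) = 0` in `K` iff `p ∣ ⌊m/p^k⌋`. [folklore] -/
theorem natCast_choose_prime_pow_eq_zero_iff (m k : ℕ) :
    ((m.choose (p ^ k) : ℕ) : K) = 0 ↔ p ∣ m / p ^ k := by
  rw [CharP.cast_eq_zero_iff K p, Nat.dvd_iff_mod_eq_zero, Nat.dvd_iff_mod_eq_zero,
    show m.choose (p ^ k) % p = (m / p ^ k) % p from choose_prime_pow_modEq_div p m k]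

/-- **Hasse derivatives of order `p^k`, `k < e`, kill `pᵉ`-th powers**: if `pᵉ ∣ m` then
`(m choose p^k) = 0` in characteristic `p` (Moh's Proposition 1 (2), "⇒"). [cite: Moh1987, §1 Proposition 1] -/
theorem natCast_choose_prime_pow_eq_zero_of_pow_dvd {m e k : ℕ} (hk : k < e) (hm : p ^ e ∣ m) :
    ((m.choose (p ^ k) : ℕ) : K) = 0 := by
  rw [natCast_choose_prime_pow_eq_zero_iff p K]
  obtain ⟨t, rfl⟩ := hm
  have hsplit : p ^ e * t = p ^ k * (p ^ (e - k) * t) := by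
    rw [← mul_assoc, ← pow_add, Nat.add_sub_cancel' hk.le]
  rw [hsplit, Nat.mul_div_cancel_left _ (pow_pos hp.out.pos k)]
  exact Dvd.dvd.mul_right (dvd_pow_self p (by omega)) t

/-- Conversely, **a non-`pᵉ`-th power is detected by some `D^{(p^k)}`, `k < e`**: if `pᵉ ∤ m` then
`(m choose p^k) ≠ 0` in characteristic `p` for `k` the `p`-adic valuation of `m` (Moh's
Proposition 1 (2), "⇐": "Let `s` be the minimal integer such that `a_s y^{s pʳ}` appears … `p ∤ s`.
Then `d^{(pʳ)}(a_s y^{s pʳ}) = s a_s y^{(s−1)pʳ} ≠ 0`"). [cite: Moh1987, §1 Proposition 1] -/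
theorem exists_natCast_choose_prime_pow_ne_zero {m e : ℕ} (hm : ¬ p ^ e ∣ m) :
    ∃ k, k < e ∧ ((m.choose (p ^ k) : ℕ) : K) ≠ 0 := by
  have hm0 : m ≠ 0 := by rintro rfl; exact hm (dvd_zero _)
  refine ⟨padicValNat p m, ?_, ?_⟩
  · by_contra hle
    exact hm ((padicValNat_dvd_iff_le hm0).mpr (not_lt.mp hle))
  · rw [Ne, natCast_choose_prime_pow_eq_zero_iff p K]
    intro hdvd
    have h1 : p ^ padicValNat p m ∣ m := (padicValNat_dvd_iff_le hm0).mpr le_rfl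
    obtain ⟨u, hu⟩ := h1
    have hu' : m / p ^ padicValNat p m = u :=
      Nat.div_eq_of_eq_mul_left (pow_pos hp.out.pos _) (by rw [mul_comm]; exact hu)
    rw [hu'] at hdvd
    apply pow_succ_padicValNat_not_dvd (p := p) hm0
    rw [pow_succ]
    calc p ^ padicValNat p m * p ∣ p ^ padicValNat p m * u := mul_dvd_mul_left _ hdvd
      _ = m := hu.symm

end Lucas

/-! ## 2. Hasse–Schmidt derivatives in one direction: monomials and translations -/

section Hasse

variable {σ : Type*} {K : Type*} [Field K] [DecidableEq σ]

/-- `D^{(a·e_i)}(c·y^m) = (m_i choose a)·c·y^{m − a·e_i}` (truncated subtraction; the binomial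
coefficient vanishes when `a > m_i`). [folklore] -/
theorem hasseDeriv_single_monomial (i : σ) (a : ℕ) (m : σ →₀ ℕ) (c : K) :
    hasseDeriv K (Finsupp.single i a) (monomial m c) =
      monomial (m - Finsupp.single i a) (c * ((m i).choose a : K)) := by
  ext γ
  rw [coeff_hasseDeriv_single, coeff_monomial, coeff_monomial]
  by_cases h : γ + Finsupp.single i a = m
  · have hmi : m i = γ i + a := by rw [← h]; simp
    have hγ : m - Finsupp.single i a = γ := by rw [← h, add_tsub_cancel_right]
    rw [if_pos h.symm, if_pos hγ, hmi, mul_comm]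
  · rw [if_neg (fun h' => h h'.symm), mul_zero]
    split_ifs with hγ
    · -- then `a > m i`
      have hlt : m i < a := by
        by_contra hle
        push Not at hle
        apply h
        rw [← hγ]
        ext t
        by_cases ht : t = i
        · subst ht; simp; omega
        · simp [ht]
      rw [Nat.choose_eq_zero_of_lt hlt, Nat.cast_zero, mul_zero]
    · rfl

omit [DecidableEq σ] in
/-- **Hasse–Schmidt derivatives commute with translations**: `D^{(α)}(P(y + b)) = (D^{(α)}P)(y + b)`
(both sides are the coefficient of `u^α` in `P(y + b + u)`). [folklore] -/
theorem hasseDeriv_translate (b : σ → K) (α : σ →₀ ℕ) (P : MvPolynomial σ K) :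
    hasseDeriv K α (PointBlowup.translate b P) = PointBlowup.translate b (hasseDeriv K α P) := by
  unfold PointBlowup.translate
  set φ : MvPolynomial σ K →ₐ[K] MvPolynomial σ K :=
    aeval fun i => (X i + C (b i) : MvPolynomial σ K) with hφ
  have key : (taylor K (σ := σ)).toRingHom.comp φ.toRingHom =
      (MvPolynomial.map φ.toRingHom).comp (taylor K (σ := σ)).toRingHom := by
    refine MvPolynomial.ringHom_ext (fun c => ?_) (fun i => ?_)
    · have h1 : φ (C c) = C c := by rw [hφ, algHom_C, algebraMap_eq]
      simp only [RingHom.comp_apply, AlgHom.toRingHom_eq_coe, RingHom.coe_coe, h1, taylor_C,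
        map_C]
    · have h1 : φ (X i) = X i + C (b i) := by rw [hφ, aeval_X]
      have h2 : φ (C (b i)) = C (b i) := by rw [hφ, algHom_C, algebraMap_eq]
      simp only [RingHom.comp_apply, AlgHom.toRingHom_eq_coe, RingHom.coe_coe, h1, map_add,
        taylor_X, taylor_C, map_C, map_X]
      ring
  have key' := RingHom.congr_fun key P
  simp only [RingHom.comp_apply, AlgHom.toRingHom_eq_coe, RingHom.coe_coe] at key'
  rw [hasseDeriv_apply, hasseDeriv_apply, key', coeff_map, RingHom.coe_coe]

end Hasse

namespace PointBlowup

/-! ## 3. The Hasse probe -/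

section Main

variable {σ : Type*} {K : Type*} [Field K] [Fintype σ] [DecidableEq σ] [DecidableEq K]
variable (p : ℕ) [hp : Fact p.Prime] [CharP K p]

/- **No increase if `q ∤ ord₀ F`** (Hauser–Perlega's assertion (2) for `c = q = pᵉ`, `m = 1`:
"`o = w·c!`", contrapositive, in every dimension) is the `e = 1` file's
`PointBlowup.shade_step_le_of_not_dvd` read with `q` in place of `p`: that theorem is stated for an
arbitrary natural number (its proof uses no primality — the lowest `y_j`-layer of the translated
chart transform has `y_j`-exponent `o − q ≢ 0 (mod q)` and survives the cleaning), so it is used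
below as `shade_step_le_of_not_dvd (p ^ e) …` and not restated. -/

/-- **The Hasse probe** (`D^{(a·e_{i₀})}`, `a = p^k`, `k < e`): if some initial monomial `y^{d₀}`
of `F` (`|d₀| = ord₀ F = o ≥ q = pᵉ`) has `((d₀)_{i₀} choose a) ≢ 0 (mod p)` for an index
`i₀ ≠ j`, then — since `D^{(a·e_{i₀})}` commutes with the translation and (up to the shift by
`y_j`) with the chart transform, and kills `q`-th powers — the Hasse derivative of the translated
chart transform `G` has a monomial in its lowest `y_j`-layer of controlled degree, and `y_{i₀}^a`
times it is a monomial of `G` surviving the cleaning. The bound is in terms of `rm = r − a·e_{i₀}`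
(truncated). [cite: HauserPerlega2019PRIMS, §5 (proof of the Theorem, assertions (7)–(9))]
[cite: Moh1987, §1 (Propositions 1–2)] -/
theorem exists_support_step_of_choose_ne_zero' {e : ℕ} (j : σ) (b : σ → K) (hbj : b j = 0)
    (s : State σ K) {o : ℕ} (ho : ordZero s.F = o) (hqo : p ^ e ≤ o)
    (hr : ∀ d ∈ s.F.support, s.r ≤ d) {i₀ : σ} (hi₀ : i₀ ≠ j) {k : ℕ} (hk : k < e)
    {d₀ : σ →₀ ℕ} (hd₀ : d₀ ∈ s.F.support) (hd₀deg : d₀.degree = o)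
    (hd₀i : ((d₀ i₀).choose (p ^ k) : K) ≠ 0) :
    ∃ E ∈ (step (p ^ e) j b s).F.support, ¬ p ^ e ∣ E i₀ ∧ E j = o - p ^ e ∧
      E.degree ≤ (((s.r - Finsupp.single i₀ (p ^ k)).update j (o - p ^ e)).filter
          (fun i => b i = 0)).degree
        + (o - p ^ k - (s.r - Finsupp.single i₀ (p ^ k)).degree) + p ^ k := by
  have hdeg := le_degree_of_ordZero_eq s ho
  set q : ℕ := p ^ e with hqdef
  set a : ℕ := p ^ k with hadef
  have ha1 : 1 ≤ a := Nat.one_le_pow _ _ hp.out.pos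
  set rm : σ →₀ ℕ := s.r - Finsupp.single i₀ a with hrmdef
  have hrmi₀ : rm i₀ = s.r i₀ - a := by
    rw [hrmdef, Finsupp.tsub_apply, Finsupp.single_eq_same]
  have hrmi : ∀ i, i ≠ i₀ → rm i = s.r i := fun i hi => by
    rw [hrmdef, Finsupp.tsub_apply, Finsupp.single_apply, if_neg (Ne.symm hi), Nat.sub_zero]
  have hrmle : ∀ i, rm i ≤ s.r i := fun i => by
    rw [hrmdef, Finsupp.tsub_apply]; exact Nat.sub_le _ _
  -- a non-vanishing binomial coefficient forces `a ≤ d i₀`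
  have hchoose_le : ∀ d : σ →₀ ℕ, ((d i₀).choose a : K) ≠ 0 → a ≤ d i₀ := by
    intro d hd
    by_contra hlt
    exact hd (by rw [Nat.choose_eq_zero_of_lt (not_le.mp hlt), Nat.cast_zero])
  have hd₀ia : a ≤ d₀ i₀ := hchoose_le d₀ hd₀i
  -- `|rm| + a ≤ o`
  have hrmo : rm.degree + a ≤ o := by
    by_cases h1 : a ≤ s.r i₀
    · have heq : rm + Finsupp.single i₀ a = s.r := by
        rw [hrmdef]; exact tsub_add_cancel_of_le (Finsupp.single_le_iff.mpr h1)
      have h2 : s.r.degree ≤ d₀.degree := degree_le_degree_of_le (hr d₀ hd₀)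
      have h3 : (rm + Finsupp.single i₀ a).degree = rm.degree + a := by
        rw [map_add, Finsupp.degree_single]
      rw [heq] at h3
      omega
    · -- `r_{i₀} < a ≤ d₀_{i₀}`: compare `rm + a e_{i₀} ≤ d₀`
      have hle : rm + Finsupp.single i₀ a ≤ d₀ := by
        rw [Finsupp.le_def]
        intro i
        rw [Finsupp.add_apply, Finsupp.single_apply]
        by_cases hi : i₀ = i
        · subst hi
          rw [if_pos rfl, hrmi₀]
          omega
        · rw [if_neg hi, add_zero, hrmi i (Ne.symm hi)]
          exact Finsupp.le_def.mp (hr d₀ hd₀) i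
      have := degree_le_degree_of_le hle
      rw [map_add, Finsupp.degree_single, hd₀deg] at this
      exact this
  set ρ : σ →₀ ℕ := rm.update j (o - q) with hρdef
  have hρj : ρ j = o - q := by rw [hρdef, Finsupp.update_apply, if_pos rfl]
  have hρi : ∀ i, i ≠ j → ρ i = rm i := fun i hi => by
    rw [hρdef, Finsupp.update_apply, if_neg hi]
  -- the probe polynomial
  set G : MvPolynomial σ K := pointTransform q j b s with hGdef
  set f : (σ →₀ ℕ) → (σ →₀ ℕ) := fun d => chartExponent q j d - Finsupp.single i₀ a with hfdef
  set g : (σ →₀ ℕ) → K := fun d => coeff d s.F * ((chartExponent q j d i₀).choose a : K)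
    with hgdef
  set Pt : MvPolynomial σ K := ∑ d ∈ s.F.support, monomial (f d) (g d) with hPt
  have hderiv : hasseDeriv K (Finsupp.single i₀ a) G = translate b Pt := by
    rw [hGdef, pointTransform_eq_sum, map_sum, hPt]
    unfold translate
    rw [map_sum]
    refine Finset.sum_congr rfl fun d _ => ?_
    have := hasseDeriv_translate b (Finsupp.single i₀ a) (monomial (chartExponent q j d) (coeff d s.F))
    unfold translate at this
    rw [this, hasseDeriv_single_monomial]
  have hchi₀ : ∀ d : σ →₀ ℕ, chartExponent q j d i₀ = d i₀ := fun d => by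
    rw [chartExponent_apply, if_neg hi₀]
  -- the terms with non-zero coefficient have `d i₀ ≥ a`
  have hgi₀ : ∀ d, g d ≠ 0 → a ≤ d i₀ := by
    intro d hgd
    have h : ((chartExponent q j d i₀).choose a : K) ≠ 0 := fun h0 => hgd (by
      rw [hgdef]; simp only [h0, mul_zero])
    rw [hchi₀ d] at h
    exact hchoose_le d h
  have hsingle_le : ∀ d : σ →₀ ℕ, a ≤ d i₀ → Finsupp.single i₀ a ≤ chartExponent q j d := by
    intro d hd
    rw [Finsupp.single_le_iff, hchi₀ d]
    exact hd
  have hsuppPt : ∀ e' ∈ Pt.support, ∃ d ∈ s.F.support, g d ≠ 0 ∧ f d = e' := fun e' he =>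
    exists_of_mem_support_sum_monomial _ _ _ he
  -- pointwise description of `f d`
  have hfj : ∀ d : σ →₀ ℕ, f d j = d.degree - q := fun d => by
    rw [hfdef]
    simp only [Finsupp.tsub_apply, chartExponent_apply, if_true, Finsupp.single_apply,
      if_neg hi₀, Nat.sub_zero]
  have hfi₀ : ∀ d : σ →₀ ℕ, f d i₀ = d i₀ - a := fun d => by
    rw [hfdef]
    simp only [Finsupp.tsub_apply, hchi₀ d, Finsupp.single_eq_same]
  have hfi : ∀ d : σ →₀ ℕ, ∀ i, i ≠ j → i ≠ i₀ → f d i = d i := fun d i hij hii₀ => by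
    rw [hfdef]
    simp only [Finsupp.tsub_apply, chartExponent_apply, if_neg hij, Finsupp.single_apply,
      if_neg (Ne.symm hii₀), Nat.sub_zero]
  have hfdeg : ∀ d : σ →₀ ℕ, a ≤ d i₀ →
      (f d).degree + a = (d.degree - q) + (d.degree - d j) := by
    intro d hd
    have h1 : f d + Finsupp.single i₀ a = chartExponent q j d := by
      rw [hfdef]; exact tsub_add_cancel_of_le (hsingle_le d hd)
    have h2 := congrArg Finsupp.degree h1
    rw [map_add, Finsupp.degree_single, degree_chartExponent] at h2
    exact h2
  have hρle : ∀ e' ∈ Pt.support, ρ ≤ e' := by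
    intro e' he
    obtain ⟨d, hd, hgd, rfl⟩ := hsuppPt e' he
    have hd1 := hgi₀ d hgd
    have hrd : ∀ i, s.r i ≤ d i := fun i => Finsupp.le_def.mp (hr d hd) i
    rw [Finsupp.le_def]
    intro i
    by_cases hij : i = j
    · subst hij
      rw [hρj, hfj]
      have := hdeg d hd
      omega
    · by_cases hii₀ : i = i₀
      · subst hii₀
        rw [hρi i hij, hrmi₀, hfi₀]
        have := hrd i
        omega
      · rw [hρi i hij, hrmi i hii₀, hfi d i hij hii₀]
        exact hrd i
  have hD : ∀ e' ∈ Pt.support, e' j = ρ j → e'.degree ≤ ρ.degree + (o - a - rm.degree) := by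
    intro e' he hej
    obtain ⟨d, hd, hgd, rfl⟩ := hsuppPt e' he
    have hd1 := hgi₀ d hgd
    rw [hfj, hρj] at hej
    have h1 := hdeg d hd
    have h2 : d.degree = o := by omega
    have h3 := hfdeg d hd1
    rw [h2] at h3
    have h4 := degree_update_add rm j (o - q)
    rw [← hρdef, hrmi j (Ne.symm hi₀)] at h4
    have h5 : s.r j ≤ d j := Finsupp.le_def.mp (hr d hd) j
    have h6 : d i₀ ≤ d.degree - d j := apply_le_degree_sub hi₀ d
    rw [h2] at h6
    have h7 : s.r j ≤ s.r.degree := Finsupp.le_degree j s.r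
    have h8 : rm.degree ≤ s.r.degree := degree_le_degree_of_le (Finsupp.le_def.mpr hrmle)
    omega
  have hgd₀ : g d₀ ≠ 0 := by
    rw [hgdef]
    refine mul_ne_zero (MvPolynomial.mem_support_iff.mp hd₀) ?_
    rw [hchi₀ d₀]
    exact hd₀i
  have hlayer : ∃ e' ∈ Pt.support, e' j = ρ j := by
    refine ⟨f d₀, ?_, ?_⟩
    · rw [MvPolynomial.mem_support_iff, hPt, coeff_sum_monomial_of_injOn s.F.support f g hd₀]
      · exact hgd₀
      · intro d hd hgd h
        have hd1 := hgi₀ d hgd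
        have h' : chartExponent q j d = chartExponent q j d₀ :=
          (tsub_left_inj (hsingle_le d hd1) (hsingle_le d₀ hd₀ia)).mp h
        exact chartExponent_injective (le_trans hqo (hdeg d hd))
          (le_trans hqo (hd₀deg ▸ le_refl _)) h'
    · rw [hfj, hd₀deg, hρj]
  obtain ⟨E', hE', hE'j, hE'deg⟩ :=
    exists_mem_support_translate_layer b hbj Pt ρ hρle (o - a - rm.degree) hD hlayer
  -- `E' + a·e_{i₀}` is a monomial of `G` surviving the cleaning
  rw [← hderiv, MvPolynomial.mem_support_iff, coeff_hasseDeriv_single] at hE'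
  have hcoeff : coeff (E' + Finsupp.single i₀ a) G ≠ 0 := fun h => hE' (by rw [h, mul_zero])
  have hcast : (((E' i₀ + a).choose a : ℕ) : K) ≠ 0 := fun h => hE' (by rw [h, zero_mul])
  set E : σ →₀ ℕ := E' + Finsupp.single i₀ a with hEdef
  have hEi₀ : E i₀ = E' i₀ + a := by
    rw [hEdef, Finsupp.add_apply, Finsupp.single_eq_same]
  have hnoti₀ : ¬ q ∣ E i₀ := by
    intro h1
    rw [hEi₀] at h1
    exact hcast (natCast_choose_prime_pow_eq_zero_of_pow_dvd p K hk h1)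
  have hnot : ¬ IsPthPowerExponent q E := fun h =>
    hnoti₀ ((isPthPowerExponent_iff q E).mp h i₀)
  have hEj : E j = o - q := by
    rw [hEdef, Finsupp.add_apply, Finsupp.single_apply, if_neg hi₀, add_zero, hE'j, hρj]
  refine ⟨E, ?_, hnoti₀, hEj, ?_⟩
  · show E ∈ (deletePthPowers q (pointTransform q j b s)).support
    rw [MvPolynomial.mem_support_iff, coeff_deletePthPowers, if_neg hnot]
    exact hcoeff
  · have hEdeg : E.degree = E'.degree + a := by
      rw [hEdef, map_add, Finsupp.degree_single]
    rw [hEdeg]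
    omega

/-- The Hasse probe, degree bound only. [cite: HauserPerlega2019PRIMS, §5 (proof of the Theorem, assertion (9))] -/
theorem exists_support_step_of_choose_ne_zero {e : ℕ} (j : σ) (b : σ → K) (hbj : b j = 0)
    (s : State σ K) {o : ℕ} (ho : ordZero s.F = o) (hqo : p ^ e ≤ o)
    (hr : ∀ d ∈ s.F.support, s.r ≤ d) {i₀ : σ} (hi₀ : i₀ ≠ j) {k : ℕ} (hk : k < e)
    {d₀ : σ →₀ ℕ} (hd₀ : d₀ ∈ s.F.support) (hd₀deg : d₀.degree = o)
    (hd₀i : ((d₀ i₀).choose (p ^ k) : K) ≠ 0) :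
    ∃ E ∈ (step (p ^ e) j b s).F.support,
      E.degree ≤ (((s.r - Finsupp.single i₀ (p ^ k)).update j (o - p ^ e)).filter
          (fun i => b i = 0)).degree
        + (o - p ^ k - (s.r - Finsupp.single i₀ (p ^ k)).degree) + p ^ k := by
  obtain ⟨E, hE, -, -, hEdeg⟩ :=
    exists_support_step_of_choose_ne_zero' p j b hbj s ho hqo hr hi₀ hk hd₀ hd₀deg hd₀i
  exact ⟨E, hE, hEdeg⟩

/-! ### The arithmetic of the sub-cases of the Hasse probe (slack `a` in place of `1`) -/

omit [Fintype σ] hp [CharP K p] in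
/-- Sub-case `r_{i₀} = 0` (a non-exceptional direction): the bound is `|r′| + shade`. [folklore] -/
theorem hasseProbe_bound_of_apply_eq_zero (j : σ) (b : σ → K) (hbj : b j = 0) (s : State σ K)
    {o q a : ℕ} (ho : ordZero s.F = o) {i₀ : σ} (hri₀ : s.r i₀ = 0)
    (hro : s.r.degree + a ≤ o) :
    (((s.r - Finsupp.single i₀ a).update j (o - q)).filter (fun i => b i = 0)).degree
        + (o - a - (s.r - Finsupp.single i₀ a).degree) + a
      = (newMult q j b s).degree + (o - s.r.degree) := by
  have heq : s.r - Finsupp.single i₀ a = s.r := by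
    ext i
    rw [Finsupp.tsub_apply, Finsupp.single_apply]
    by_cases hi : i₀ = i
    · subst hi; rw [if_pos rfl, hri₀, Nat.zero_sub]
    · rw [if_neg hi, Nat.sub_zero]
  rw [heq, newMult_eq q j b hbj s ho]
  omega

omit [Fintype σ] hp [CharP K p] in
/-- Sub-case `b_{i₀} = 0` (the exceptional component `{y_{i₀} = 0}` passes through the new point): the
bound is again `|r′| + shade`. [folklore] -/
theorem hasseProbe_bound_of_translate_eq_zero (j : σ) (b : σ → K) (hbj : b j = 0) (s : State σ K)
    {o q a : ℕ} (ho : ordZero s.F = o) {i₀ : σ} (hi₀ : i₀ ≠ j) (hbi₀ : b i₀ = 0)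
    (hro : (s.r - Finsupp.single i₀ a).degree + a ≤ o) (hro' : s.r.degree ≤ o) :
    (((s.r - Finsupp.single i₀ a).update j (o - q)).filter (fun i => b i = 0)).degree
        + (o - a - (s.r - Finsupp.single i₀ a).degree) + a
      ≤ (newMult q j b s).degree + (o - s.r.degree) := by
  -- `rm + m e_{i₀} = r` with `m = min a r_{i₀}`, and the same after `update`/`filter`
  set m : ℕ := min a (s.r i₀) with hm
  have h1 : (s.r - Finsupp.single i₀ a) + Finsupp.single i₀ m = s.r := by
    ext i
    rw [Finsupp.add_apply, Finsupp.tsub_apply, Finsupp.single_apply, Finsupp.single_apply]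
    by_cases hi : i₀ = i
    · subst hi; rw [if_pos rfl, if_pos rfl, hm]; omega
    · rw [if_neg hi, if_neg hi]; omega
  have h1d : (s.r - Finsupp.single i₀ a).degree + m = s.r.degree := by
    have := congrArg Finsupp.degree h1
    rwa [map_add, Finsupp.degree_single] at this
  have h2 : ((s.r - Finsupp.single i₀ a).update j (o - q)).filter (fun i => b i = 0)
      + Finsupp.single i₀ m = (s.r.update j (o - q)).filter (fun i => b i = 0) := by
    ext i
    simp only [Finsupp.add_apply, Finsupp.filter_apply, Finsupp.update_apply,
      Finsupp.tsub_apply, Finsupp.single_apply]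
    by_cases hij : i = j
    · subst hij; simp [hi₀]
    · by_cases hii : i₀ = i
      · subst hii; simp [hij, hbi₀, hm]; omega
      · simp [hii]
  have h2d := congrArg Finsupp.degree h2
  rw [map_add, Finsupp.degree_single, ← newMult_eq q j b hbj s ho] at h2d
  have hm_le : m ≤ a := min_le_left _ _
  omega

omit hp [CharP K p] in
/-- General sub-case: the bound is at most `|r′| + shade + min(a, r_{i₀})`. [folklore] -/
theorem hasseProbe_bound_le (j : σ) (b : σ → K) (hbj : b j = 0) (s : State σ K)
    {o q a : ℕ} (ho : ordZero s.F = o) (i₀ : σ)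
    (hro : (s.r - Finsupp.single i₀ a).degree + a ≤ o) :
    (((s.r - Finsupp.single i₀ a).update j (o - q)).filter (fun i => b i = 0)).degree
        + (o - a - (s.r - Finsupp.single i₀ a).degree) + a
      ≤ (newMult q j b s).degree + (o - s.r.degree) + min a (s.r i₀) := by
  set m : ℕ := min a (s.r i₀) with hm
  have h1 : ((s.r - Finsupp.single i₀ a).update j (o - q)).filter (fun i => b i = 0)
      ≤ (s.r.update j (o - q)).filter (fun i => b i = 0) := by
    rw [Finsupp.le_def]
    intro i
    simp only [Finsupp.filter_apply, Finsupp.update_apply, Finsupp.tsub_apply]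
    split_ifs <;> omega
  have h1d := degree_le_degree_of_le h1
  rw [← newMult_eq q j b hbj s ho] at h1d
  have h2 : (s.r - Finsupp.single i₀ a) + Finsupp.single i₀ m = s.r := by
    ext i
    rw [Finsupp.add_apply, Finsupp.tsub_apply, Finsupp.single_apply, Finsupp.single_apply]
    by_cases hi : i₀ = i
    · subst hi; rw [if_pos rfl, if_pos rfl, hm]; omega
    · rw [if_neg hi, if_neg hi]; omega
  have h2d : (s.r - Finsupp.single i₀ a).degree + m = s.r.degree := by
    have := congrArg Finsupp.degree h2
    rwa [map_add, Finsupp.degree_single] at this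
  have hm_le : m ≤ a := min_le_left _ _
  omega

/-! ### The theorems -/

/-- **No increase when an initial monomial of `F` has `(d choose p^k) ≢ 0 (mod p)` (`k < e`) at
an index `i₀ ≠ j` which is untranslated (`b_{i₀} = 0`) or non-exceptional (`r_{i₀} = 0`)**
(Hauser–Perlega's assertion (7) for `c = q`, read in fixed coordinates, contrapositive, in every
dimension; their slack `ε_{i,k} = 0` for `i ∉ A`). [cite: HauserPerlega2019PRIMS, §3 Theorem (7)] -/
theorem shade_step_le_of_choose_ne_zero {e : ℕ} (j : σ) (b : σ → K) (hbj : b j = 0)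
    (s : State σ K) {o : ℕ} (ho : ordZero s.F = o) (hqo : p ^ e ≤ o)
    (hr : ∀ d ∈ s.F.support, s.r ≤ d) {i₀ : σ} (hi₀ : i₀ ≠ j) (hfix : b i₀ = 0 ∨ s.r i₀ = 0)
    {k : ℕ} (hk : k < e) {d₀ : σ →₀ ℕ} (hd₀ : d₀ ∈ s.F.support) (hd₀deg : d₀.degree = o)
    (hd₀i : ((d₀ i₀).choose (p ^ k) : K) ≠ 0) :
    (step (p ^ e) j b s).shade ≤ s.shade := by
  obtain ⟨E, hE, hEdeg⟩ :=
    exists_support_step_of_choose_ne_zero p j b hbj s ho hqo hr hi₀ hk hd₀ hd₀deg hd₀i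
  rw [shade_eq_of_ordZero_eq s ho]
  refine shade_le_of_mem_support _ hE ?_
  have ha : p ^ k ≤ d₀ i₀ := by
    by_contra hlt
    exact hd₀i (by rw [Nat.choose_eq_zero_of_lt (not_le.mp hlt), Nat.cast_zero])
  have hro' : s.r.degree ≤ o := hd₀deg ▸ degree_le_degree_of_le (hr d₀ hd₀)
  -- `|rm| + a ≤ o`
  have hrmo : (s.r - Finsupp.single i₀ (p ^ k)).degree + p ^ k ≤ o := by
    have hle : (s.r - Finsupp.single i₀ (p ^ k)) + Finsupp.single i₀ (p ^ k) ≤ d₀ := by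
      rw [Finsupp.le_def]
      intro i
      rw [Finsupp.add_apply, Finsupp.tsub_apply, Finsupp.single_apply]
      by_cases hi : i₀ = i
      · subst hi; rw [if_pos rfl]
        have := Finsupp.le_def.mp (hr d₀ hd₀) i₀
        omega
      · rw [if_neg hi, add_zero, Nat.sub_zero]
        exact Finsupp.le_def.mp (hr d₀ hd₀) i
    have := degree_le_degree_of_le hle
    rw [map_add, Finsupp.degree_single, hd₀deg] at this
    exact this
  rcases hfix with hb | hr0
  · exact le_trans hEdeg
      (hasseProbe_bound_of_translate_eq_zero j b hbj s ho hi₀ hb hrmo hro')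
  · have hro'' : s.r.degree + p ^ k ≤ o := by
      have heq : s.r - Finsupp.single i₀ (p ^ k) = s.r := by
        ext i
        rw [Finsupp.tsub_apply, Finsupp.single_apply]
        by_cases hi : i₀ = i
        · subst hi; rw [if_pos rfl, hr0, Nat.zero_sub]
        · rw [if_neg hi, Nat.sub_zero]
      rw [heq] at hrmo
      exact hrmo
    rw [hasseProbe_bound_of_apply_eq_zero j b hbj s ho hr0 hro''] at hEdeg
    exact hEdeg

/-- **The quantitative Hasse probe**: under the same hypothesis at an arbitrary index `i₀ ≠ j`,
`shade′ ≤ shade + min(p^k, r_{i₀})` — Hauser–Perlega's slack `ε_{i,k} = p^k` for an exceptional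
index `i ∈ A` ("`ord(F + G^q) ≤ ord ∂_{x_i^{p^k}}(F) + p^k`"). [cite: HauserPerlega2019PRIMS, §5 (proof of the Theorem, assertion (9))] -/
theorem shade_step_le_add_of_choose_ne_zero {e : ℕ} (j : σ) (b : σ → K) (hbj : b j = 0)
    (s : State σ K) {o : ℕ} (ho : ordZero s.F = o) (hqo : p ^ e ≤ o)
    (hr : ∀ d ∈ s.F.support, s.r ≤ d) {i₀ : σ} (hi₀ : i₀ ≠ j)
    {k : ℕ} (hk : k < e) {d₀ : σ →₀ ℕ} (hd₀ : d₀ ∈ s.F.support) (hd₀deg : d₀.degree = o)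
    (hd₀i : ((d₀ i₀).choose (p ^ k) : K) ≠ 0) :
    (step (p ^ e) j b s).shade ≤ s.shade + ((min (p ^ k) (s.r i₀) : ℕ) : ℕ∞) := by
  obtain ⟨E, hE, hEdeg⟩ :=
    exists_support_step_of_choose_ne_zero p j b hbj s ho hqo hr hi₀ hk hd₀ hd₀deg hd₀i
  have ha : p ^ k ≤ d₀ i₀ := by
    by_contra hlt
    exact hd₀i (by rw [Nat.choose_eq_zero_of_lt (not_le.mp hlt), Nat.cast_zero])
  have hrmo : (s.r - Finsupp.single i₀ (p ^ k)).degree + p ^ k ≤ o := by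
    have hle : (s.r - Finsupp.single i₀ (p ^ k)) + Finsupp.single i₀ (p ^ k) ≤ d₀ := by
      rw [Finsupp.le_def]
      intro i
      rw [Finsupp.add_apply, Finsupp.tsub_apply, Finsupp.single_apply]
      by_cases hi : i₀ = i
      · subst hi; rw [if_pos rfl]
        have := Finsupp.le_def.mp (hr d₀ hd₀) i₀
        omega
      · rw [if_neg hi, add_zero, Nat.sub_zero]
        exact Finsupp.le_def.mp (hr d₀ hd₀) i
    have := degree_le_degree_of_le hle
    rw [map_add, Finsupp.degree_single, hd₀deg] at this
    exact this
  have hb := hasseProbe_bound_le j b hbj s ho i₀ hrmo (q := p ^ e)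
  have h1 : E.degree ≤ (step (p ^ e) j b s).r.degree + ((o - s.r.degree) + min (p ^ k) (s.r i₀)) := by
    show E.degree ≤ (newMult (p ^ e) j b s).degree + _
    omega
  have h2 := shade_le_of_mem_support _ hE h1
  rw [shade_eq_of_ordZero_eq s ho]
  push_cast
  exact h2

/-- **The `ℓ`-form of Hauser–Perlega's (9) / Moh's "in fact `d + pʳ`"**: if the initial form of
the cleaned residual polynomial `F` (order `o ≥ q = pᵉ`) is NOT a `p^{ℓ+1}`-th power — some
initial monomial `y^{d₀}` has an exponent `(d₀)_i` not divisible by `p^{ℓ+1}` — and `ℓ < e`, then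
`shade′ ≤ shade + p^ℓ` at every point `b` of the exceptional divisor of every chart ("`ℓ` maximal
such that `F` is a `p^ℓ`-th power … `ord I₁′ ≤ ord I + (c!/q)·p^ℓ`").
[cite: HauserPerlega2019PRIMS, §3 Theorem (9) and its proof] [cite: Moh1987, Stability Theorem ("in fact, d + p^r")] -/
theorem shade_step_le_add_pow {e ℓ : ℕ} (hℓ : ℓ < e) (j : σ) (b : σ → K) (hbj : b j = 0)
    (s : State σ K) {o : ℕ} (ho : ordZero s.F = o) (hqo : p ^ e ≤ o)
    (hr : ∀ d ∈ s.F.support, s.r ≤ d)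
    (hinit : ∃ d₀ ∈ s.F.support, d₀.degree = o ∧ ∃ i, ¬ p ^ (ℓ + 1) ∣ d₀ i) :
    (step (p ^ e) j b s).shade ≤ s.shade + ((p ^ ℓ : ℕ) : ℕ∞) := by
  -- either some initial exponent at an index `≠ j` is not divisible by `p^(ℓ+1)` …
  by_cases hcase : ∃ d ∈ s.F.support, d.degree = o ∧ ∃ i, i ≠ j ∧ ¬ p ^ (ℓ + 1) ∣ d i
  · obtain ⟨d, hd, hddeg, i₀, hi₀, hndvd⟩ := hcase
    obtain ⟨k, hk, hk0⟩ := exists_natCast_choose_prime_pow_ne_zero p K hndvd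
    have hke : k < e := by omega
    have h := shade_step_le_add_of_choose_ne_zero p j b hbj s ho hqo hr hi₀ hke hd hddeg hk0
    have hmin : min (p ^ k) (s.r i₀) ≤ p ^ ℓ :=
      le_trans (min_le_left _ _) (Nat.pow_le_pow_right hp.out.pos (by omega))
    have hmin' : ((min (p ^ k) (s.r i₀) : ℕ) : ℕ∞) ≤ ((p ^ ℓ : ℕ) : ℕ∞) := by exact_mod_cast hmin
    exact le_trans h (add_le_add le_rfl hmin')
  · -- … or all of them are, and then `p^(ℓ+1) ∤ o`, so `q ∤ o`: no increase at all
    push Not at hcase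
    obtain ⟨d₀, hd₀, hd₀deg, i, hi⟩ := hinit
    have hij : i = j := by
      by_contra hne
      exact hi (hcase d₀ hd₀ hd₀deg i hne)
    subst hij
    have hndvd : ¬ p ^ (ℓ + 1) ∣ o := by
      intro ho'
      apply hi
      rw [← hd₀deg, degree_eq_add_sum_erase i d₀] at ho'
      have hsum : p ^ (ℓ + 1) ∣ ∑ k ∈ univ.erase i, d₀ k :=
        Finset.dvd_sum fun k hk => hcase d₀ hd₀ hd₀deg k (Finset.ne_of_mem_erase hk)
      exact (Nat.dvd_add_left hsum).mp ho'
    have hndvd' : ¬ p ^ e ∣ o := fun h =>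
      hndvd (dvd_trans (pow_dvd_pow p (by omega)) h)
    exact le_trans (shade_step_le_of_not_dvd (p ^ e) i b hbj s ho hqo hr hndvd') le_self_add

/-- **Moh's bound at order `pᵉ`, in every dimension, for every `e ≥ 1`.** For a cleaned residual
polynomial `F` of `x^{pᵉ} + F(y₁, …, y_m)` (no `pᵉ`-th power monomials), of order `≥ pᵉ`,
divisible by the exceptional monomial `yʳ`, and ANY point `b` of the exceptional divisor of the
blow-up of the origin (chart `y_j`, `b_j = 0`; any number `m` of variables, any field of
characteristic `p`, no equimultiplicity hypothesis needed), the shade after the blow-up and the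
cleaning is at most the shade before plus `p^{e−1}`: `MohBound p e j b s`. Moh states it for
`z^{pᵉ} + F(x₁,…,x_n)` and all `n` ("`ord F̄ ≤ d + p^{e−1}`"); Hauser–Perlega prove the bound
`+ c!/p` for arbitrary ideals of order `c = m·pᵉ` in any dimension (here `c = pᵉ`); Hauser 2010
§F states it as "`shade_{a′} f′ ≤ shade_a f + p^{e−1}`".
[cite: Moh1987, Stability Theorem (one permissible blow-up), §1 Propositions 1–2]
[cite: HauserPerlega2019PRIMS, §3 Theorem (9)] [cite: Hauser2010, §F Proposition (Moh)] -/
theorem mohBound {e : ℕ} (he : 1 ≤ e) (j : σ) (b : σ → K) (hbj : b j = 0) (s : State σ K)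
    (hclean : deletePthPowers (p ^ e) s.F = s.F) (hord : ((p ^ e : ℕ) : ℕ∞) ≤ ordZero s.F)
    (hr : ∀ d ∈ s.F.support, s.r ≤ d) : MohBound p e j b s := by
  unfold MohBound
  by_cases hF : s.F = 0
  · have : s.shade = ⊤ := by
      unfold State.shade
      rw [hF, ordZero_zero, ENat.top_sub_coe]
    rw [this, top_add]
    exact le_top
  have hne : ordZero s.F ≠ ⊤ := by
    unfold ordZero
    rw [Ne, MvPowerSeries.order_eq_top_iff, MvPolynomial.coe_eq_zero_iff]
    exact hF
  obtain ⟨o, ho'⟩ := WithTop.ne_top_iff_exists.mp hne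
  have ho : ordZero s.F = o := ho'.symm
  have hqo : p ^ e ≤ o := by
    rw [ho] at hord
    exact_mod_cast hord
  -- an initial monomial is not a `q`-th power: some exponent is not divisible by `p^e = p^((e-1)+1)`
  obtain ⟨⟨d₀, hd₀, hd₀deg⟩, -⟩ := (ordZero_eq_nat_iff _ _).mp ho
  have hd₀s : d₀ ∈ s.F.support := MvPolynomial.mem_support_iff.mpr hd₀
  have hnp := not_isPthPowerExponent_of_clean (p ^ e) hclean hd₀s
  rw [isPthPowerExponent_iff] at hnp
  push Not at hnp
  obtain ⟨i, hi⟩ := hnp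
  have he' : e - 1 + 1 = e := by omega
  have hinit : ∃ d₀ ∈ s.F.support, d₀.degree = o ∧ ∃ i, ¬ p ^ (e - 1 + 1) ∣ d₀ i :=
    ⟨d₀, hd₀s, hd₀deg, i, by rw [he']; exact hi⟩
  exact shade_step_le_add_pow p (by omega) j b hbj s ho hqo hr hinit

/-- **Necessary conditions for an increase of the shade at order `pᵉ`, in every dimension**
(Hauser–Perlega's assertions (2) and (7), and the "lost component" half of (6), for `c = q = pᵉ`,
read in fixed coordinates): if the shade increases at the point `b` of the `y_j`-chart then
(i) `q ∣ ord₀ F` (`= |r| + shade`); (ii) for every index `i ≠ j` which is untranslated (`b_i = 0`)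
or non-exceptional (`r_i = 0`), the variable `y_i` occurs in the initial form of `F` only with
exponents divisible by `q`; (iii) consequently some EXCEPTIONAL component `{y_i = 0}`, `r_i ≥ 1`,
`i ≠ j`, is lost at `b` (`b_i ≠ 0`) and carries an initial exponent not divisible by `q` —
together with `{y_j = 0}`, "at least two components of `D` are lost" when `r_j ≥ 1`.
[cite: HauserPerlega2019PRIMS, §3 Theorem (2), (7) and Comment (d)] -/
theorem necessary_of_shadeIncreases_pow {e : ℕ} (j : σ) (b : σ → K) (hbj : b j = 0)
    (s : State σ K) (hclean : deletePthPowers (p ^ e) s.F = s.F) {o : ℕ} (ho : ordZero s.F = o)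
    (hqo : p ^ e ≤ o) (hr : ∀ d ∈ s.F.support, s.r ≤ d) (hinc : ShadeIncreases (p ^ e) j b s) :
    p ^ e ∣ o ∧
    (∀ i, i ≠ j → (b i = 0 ∨ s.r i = 0) → ∀ d ∈ s.F.support, d.degree = o → p ^ e ∣ d i) ∧
    (∃ i, i ≠ j ∧ b i ≠ 0 ∧ s.r i ≠ 0 ∧ ∃ d ∈ s.F.support, d.degree = o ∧ ¬ p ^ e ∣ d i) := by
  unfold ShadeIncreases at hinc
  have h1 : p ^ e ∣ o := by
    by_contra hndvd
    exact absurd (shade_step_le_of_not_dvd (p ^ e) j b hbj s ho hqo hr hndvd) (not_le.mpr hinc)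
  have h2 : ∀ i, i ≠ j → (b i = 0 ∨ s.r i = 0) →
      ∀ d ∈ s.F.support, d.degree = o → p ^ e ∣ d i := by
    intro i hij hfix d hd hddeg
    by_contra hndvd
    obtain ⟨k, hk, hk0⟩ := exists_natCast_choose_prime_pow_ne_zero p K hndvd
    exact absurd (shade_step_le_of_choose_ne_zero p j b hbj s ho hqo hr hij hfix hk hd hddeg hk0)
      (not_le.mpr hinc)
  refine ⟨h1, h2, ?_⟩
  obtain ⟨⟨d₀, hd₀, hd₀deg⟩, -⟩ := (ordZero_eq_nat_iff _ _).mp ho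
  have hd₀s : d₀ ∈ s.F.support := MvPolynomial.mem_support_iff.mpr hd₀
  have hnp := not_isPthPowerExponent_of_clean (p ^ e) hclean hd₀s
  -- an index `i₀ ≠ j` with `q ∤ d₀ i₀` (if all `i ≠ j` were divisible, so would be `d₀ j`, by (i))
  obtain ⟨i₀, hi₀, hd₀i⟩ : ∃ i, i ≠ j ∧ ¬ p ^ e ∣ d₀ i :=
    exists_ne_not_dvd (p ^ e) j (hd₀deg.symm ▸ h1) hnp
  refine ⟨i₀, hi₀, ?_, ?_, d₀, hd₀s, hd₀deg, hd₀i⟩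
  · intro hb; exact hd₀i (h2 i₀ hi₀ (Or.inl hb) d₀ hd₀s hd₀deg)
  · intro hr0; exact hd₀i (h2 i₀ hi₀ (Or.inr hr0) d₀ hd₀s hd₀deg)

/-- **Moh's bound along a sequence of point blow-ups at order `pᵉ`, in every dimension.** Starting
from a cleaned state whose residual polynomial is divisible by its exceptional monomial, along ANY
sequence of point blow-ups (`s_{n+1} = step q (j n) (b n) s_n`, `q = pᵉ`, `e ≥ 1`, points `b n` on
the new exceptional divisor, `b n (j n) = 0`) on which the order stays `≥ q` (the equimultiple
branch), every single step raises the shade by at most `p^{e−1}`. (What is NOT asserted: any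
eventual bound along the sequence — Moh's "Stability Theorem" proper, proved in the tree for `e = 1`
(`PointBlowupMohStability.lean`), refuted by Hauser–Perlega for `e ≥ 3`
(`mohStabilityClaim_false`), and not decided in print for `e = 2`.)
[cite: Moh1987, Stability Theorem (one permissible blow-up), §1]
[cite: Hauser2010, §F Proposition (Moh)] -/
theorem shade_succ_le_along_pow {e : ℕ} (he : 1 ≤ e) (s : ℕ → State σ K) (j : ℕ → σ)
    (b : ℕ → σ → K) (hb : ∀ n, b n (j n) = 0)
    (hstep : ∀ n, s (n + 1) = step (p ^ e) (j n) (b n) (s n))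
    (hclean : deletePthPowers (p ^ e) (s 0).F = (s 0).F)
    (hr : ∀ d ∈ (s 0).F.support, (s 0).r ≤ d)
    (hord : ∀ n, ((p ^ e : ℕ) : ℕ∞) ≤ ordZero (s n).F) (n : ℕ) :
    (s (n + 1)).shade ≤ (s n).shade + ((p ^ (e - 1) : ℕ) : ℕ∞) := by
  -- the two structural hypotheses persist
  have hinv : ∀ n, deletePthPowers (p ^ e) (s n).F = (s n).F ∧
      ∀ d ∈ (s n).F.support, (s n).r ≤ d := by
    intro n
    induction n with
    | zero => exact ⟨hclean, hr⟩
    | succ n ih =>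
      obtain ⟨_, ih2⟩ := ih
      rw [hstep n]
      refine ⟨deletePthPowers_step (p ^ e) (j n) (b n) (s n), ?_⟩
      by_cases hF : (s n).F = 0
      · -- terminal state: the step of the zero polynomial is zero
        intro E hE
        exfalso
        have : (step (p ^ e) (j n) (b n) (s n)).F = 0 := by
          change deletePthPowers (p ^ e)
            (translate (b n) (chartTransform (p ^ e) (j n) (s n).F)) = 0
          rw [hF]
          unfold chartTransform
          rw [MvPolynomial.support_zero, Finset.sum_empty]
          unfold translate
          rw [map_zero, deletePthPowers_zero]
        rw [this, MvPolynomial.support_zero] at hE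
        exact Finset.notMem_empty _ hE
      · have hne : ordZero (s n).F ≠ ⊤ := by
          unfold ordZero
          rw [Ne, MvPowerSeries.order_eq_top_iff, MvPolynomial.coe_eq_zero_iff]
          exact hF
        obtain ⟨o, ho'⟩ := WithTop.ne_top_iff_exists.mp hne
        exact newMult_le_of_mem_support_step (p ^ e) (j n) (b n) (hb n) (s n) ho'.symm ih2
  obtain ⟨h1, h2⟩ := hinv n
  have hM := mohBound p he (j n) (b n) (hb n) (s n) h1 (hord n) h2
  unfold MohBound at hM
  rw [← hstep n] at hM
  exact hM

end Main

end PointBlowup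

end Literature.AlgebraicGeometry.Resolution

end
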